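import Summits.AtomisticToContinuum.HydrodynamicLimit.Theorems.EvenStressEnskog.Negative.PairFunctionalVanishing

/-!
# Sketch — crux-ideate round 1, ideator 1, crux `EvenStressEnskog` (stmt-AtomisticToContinuum-13079)

First-lemma signatures for the three idea cards (statements only; they must elaborate):

* card A `liouville-continuity-pins-universal-contact-value`:
  `EvenStressWith` (the crux with the contact-value function as a parameter),
  `evenStressEnskog_iff` (kernel check that the parametrisation is faithful, `Iff.rfl`),
  `UniversalContactValue` (the transfer C⁺), `FirstLemmaA` (band agreement ⇒ crux) — PROVED below as
  `firstLemmaA_holds` (axioms propext / Classical.choice / Quot.sound), `IsothermalEntropyBudget` (the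
  lever: exact finite-`N` entropy budget).
* card C `dynamical-kirkwood-salsburg-incoming-chaos`: `PairTransportIdentity`
  (the `n = 2` member of the empirical stationary-hierarchy family; `n = 1` is the route support
  `EmpiricalEnskogIdentity`, stmt-13086).
* card B′ `equilibrium-rung-dynamical-virial`: `ConstantProfileInvariance` (rung 0 input).
-/

namespace Summit.AtomisticToContinuum.HydrodynamicLimit.Cruxes.EvenStressEnskog.IdeatorOne

open scoped BigOperators Topology Classical MeasureTheory ProbabilityTheory Matrix InnerProductSpace RealInnerProductSpace
open Filter Set Function MeasureTheory
open Literature.MathematicalPhysics.KineticTheory Literature.Analysis.FluidPDE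

/-! ## Card A -/

/-- The crux `EvenStressEnskog` with the contact-value function `Yf : ℝ → ℝ` as a parameter
(verbatim body, only the `let Y := …` line replaced). -/
def EvenStressWith (Yf : ℝ → ℝ) : Prop :=
  ∃ η₀ : ℝ, 0 < η₀ ∧ ∀ (a₀ θ₀ : Literature.MathematicalPhysics.KineticTheory.T3 → ℝ) (u₀ : Literature.MathematicalPhysics.KineticTheory.T3 → Literature.MathematicalPhysics.KineticTheory.V3), Continuous a₀ → Continuous θ₀ → Continuous u₀ → (∀ x, 0 < a₀ x) → (∀ x, 0 < θ₀ x) → ∃ σ₀ : ℝ, 0 < σ₀ ∧ ∀ σ : ℝ, 0 < σ → σ < σ₀ → ∀ Φ : (N : ℕ) → Literature.Analysis.FluidPDE.HardSphereFlow (Literature.Analysis.FluidPDE.Torus.geometry (Fin 3)) (Literature.MathematicalPhysics.KineticTheory.hsDiameter σ N) (N + 1), ∀ τ : ℝ, 0 < τ → ∀ χ : ℝ × UnitAddTorus (Fin 3) → ℝ, Continuous χ → ∀ g : ℝ → ℝ, Continuous g → (∀ a, η₀ ≤ a → g a = 0) → ∀ η δ : ℝ, 0 < η → 0 < δ → ∃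 r₀ : ℝ, 0 < r₀ ∧ ∀ r : ℝ, 0 < r → r < r₀ → ∃ N₀ : ℕ, ∀ N : ℕ, N₀ ≤ N → let ε := Literature.MathematicalPhysics.KineticTheory.hsDiameter σ N; let G := Literature.Analysis.FluidPDE.Torus.geometry (Fin 3); let γ := fun z (s : ℝ) => (Φ N).flow s z; let bx : UnitAddTorus (Fin 3) → UnitAddTorus (Fin 3) → ℝ := fun x y => 3 / (Real.pi * r ^ 3) * max (1 - Literature.Analysis.FluidPDE.Torus.euclidDist x y / r) 0; let ρm := fun z s (x₀ : UnitAddTorus (Fin 3)) => ∫ q, bx q.1 x₀ ∂(Literature.Analysis.FluidPDE.empiricalMeasure (γ z s)); let Θ := fun (Ξ : EuclideanSpace ℝ (Fin 3) × EuclideanSpace ℝ (Fin 3) × EuclideanSpace ℝ (Fin 3) → ℝ) (v w : EuclideanSpace ℝ (Fin 3)) => ∫ ω : Metric.sphere (0 : EuclideanSpace ℝ (Fin 3)) 1, Ξ ((ω : EuclideanSpace ℝ (Fin 3)), v, w) * Literature.MathematicalPhysics.KineticTheory.hardSphereKernel (w, v) ω ∂Literature.MathematicalPhysics.KineticTheory.sphereMeasure;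 let B := fun Ξ z s (x₀ : UnitAddTorus (Fin 3)) => ∫ p, bx p.1.1 x₀ * bx p.2.1 x₀ * Θ Ξ p.1.2 p.2.2 ∂((Literature.Analysis.FluidPDE.empiricalMeasure (γ z s)).prod (Literature.Analysis.FluidPDE.empiricalMeasure (γ z s))); let pv := fun z s (i j : Fin (N + 1)) => Literature.Analysis.FluidPDE.reflectVel (G.sepVec (γ z s i).1 (γ z s j).1) ((γ z s i).2, (γ z s j).2); let Kc := fun (Fn : Literature.Analysis.FluidPDE.Config (N + 1) (Fin 3) Literature.MathematicalPhysics.KineticTheory.T3 → ℝ → Fin (N + 1) → Fin (N + 1) → ℝ) z => ε / (N + 1 : ℝ) * ∑ᶠ (s : ℝ) (_ : s ∈ Literature.Analysis.FluidPDE.collisionTimes G ε (γ z) ∩ Set.Icc 0 τ), ∑ i : Fin (N + 1), ∑ j : Fin (N + 1), (if i ≠ j ∧ ‖G.sepVec (γ z s i).1 (γ z s j).1‖ = ε then Fn z s i j else 0); let Y : ℝ → ℝ := Yf; let Dm := fun (Ξ : EuclideanSpace ℝ (Fin 3) × EuclideanSpace ℝ (Fin 3) × EuclideanSpace ℝ (Fin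 3) → ℝ) z => Kc (fun z s i j => χ (s, (γ z s i).1) * g (σ ^ 3 * ρm z s (γ z s i).1) * Ξ (ε⁻¹ • G.sepVec (γ z s i).1 (γ z s j).1, (pv z s i j).1, (pv z s i j).2)) z - σ ^ 3 * ∫ s in Set.Icc (0 : ℝ) τ, ∫ x : UnitAddTorus (Fin 3), χ (s, x) * g (σ ^ 3 * ρm z s x) * Y (σ ^ 3 * ρm z s x) * B Ξ z s x; let ΞP := fun (k l : Fin 3) (q : EuclideanSpace ℝ (Fin 3) × EuclideanSpace ℝ (Fin 3) × EuclideanSpace ℝ (Fin 3)) => max ⟪q.2.2 - q.2.1, q.1⟫_ℝ 0 * (q.1 k * q.1 l); ∀ k l : Fin 3, Literature.MathematicalPhysics.KineticTheory.localGibbsLaw σ a₀ u₀ θ₀ N (Φ N) {z | η < |Dm (ΞP k l) z|} ≤ ENNReal.ofReal δ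

/-- Faithfulness of the parametrisation: the crux IS `EvenStressWith` at the thermodynamic
contact value `Y(η) = (3/2π)·f_ex′(η)` (definitional). -/
theorem evenStressEnskog_iff :
    Summit.AtomisticToContinuum.HydrodynamicLimit.Theses.JParityClosure.EvenStressEnskog ↔
      EvenStressWith (fun a => 3 / (2 * Real.pi) *
        deriv Literature.MathematicalPhysics.KineticTheory.hsExcessFreeEnergy a) :=
  Iff.rfl

/-- TRANSFER C⁺ of card A — UNIVERSALITY of the dynamical contact value: the J-even collisional
momentum-transfer statistic of the true flow is slaved to the local reduced density through SOME
continuous, locally bounded function `Ỹ` (no identification with thermodynamics). Strictly weaker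
than the crux (take `Ỹ = Y`). -/
def UniversalContactValue : Prop :=
  ∃ Yt : ℝ → ℝ, ContinuousOn Yt (Set.Ioi 0) ∧ (∃ C : ℝ, ∀ a ∈ Set.Ioo (0 : ℝ) 1, |Yt a| ≤ C) ∧
    EvenStressWith Yt

/-- FIRST LEMMA A (rewriting step of the line, provable now): if the statistic is universal with
some `Ỹ` that agrees with `Y` on a band `(0, η₁)`, the crux holds — because the prediction
integrand `χ g(σ³ρ_r) Ỹ(σ³ρ_r) B_r` vanishes where `ρ_r = 0` (`B_r = 0`) and where `σ³ρ_r ≥ η₀`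
(`g = 0`), so shrinking `η₀` to `min η₀ η₁` makes the two `Dm`'s equal surely. -/
def FirstLemmaA : Prop :=
  ∀ Yt : ℝ → ℝ, EvenStressWith Yt →
    (∃ η₁ : ℝ, 0 < η₁ ∧ Set.EqOn Yt (fun a => 3 / (2 * Real.pi) *
        deriv Literature.MathematicalPhysics.KineticTheory.hsExcessFreeEnergy a) (Set.Ioo 0 η₁)) →
    Summit.AtomisticToContinuum.HydrodynamicLimit.Theses.JParityClosure.EvenStressEnskog

/-- THE LEVER of card A in finite-`N` form — ISOTHERMAL ENTROPY BUDGET (exact, every `N`, every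
`σ`): for isothermal zero-drift local Gibbs data (`θ₀ ≡ θ`, `u₀ ≡ 0`, activity `a₀` with
`L`-Lipschitz logarithm) Liouville invariance and energy conservation give the IDENTITY
`H(P_t | LG) = E_LG Σ_i [log a₀(x_i(0)) − log a₀(x_i(t))]` (the Maxwellian factor of `log LG` is a
function of the conserved kinetic energy, the partition function cancels), hence, by the path-length
bound `dist(x_i(t),x_i(0)) ≤ ∫₀ᵗ|v_i|` and Cauchy–Schwarz against the conserved energy,
`H(P_t | LG) ≤ (N+1)·L·√(3θ)·t`: the law can drift away from the INITIAL local Gibbs law by at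
most `O(t)` nats per particle. No cubic velocity moment, no collision count is needed. -/
def IsothermalEntropyBudget : Prop :=
  ∀ (σ θ L : ℝ) (a₀ : T3 → ℝ), 0 < θ → 0 ≤ L → Continuous a₀ → (∀ x, 0 < a₀ x) →
    (∀ x y, |Real.log (a₀ x) - Real.log (a₀ y)| ≤
        L * Literature.Analysis.FluidPDE.Torus.euclidDist x y) →
    ∀ (N : ℕ) (Φ : HardSphereFlow (Torus.geometry (Fin 3)) (hsDiameter σ N) (N + 1)) (t : ℝ),
      0 ≤ t →
      InformationTheory.klDiv
          (Φ.lawAt (localGibbsLaw σ a₀ (fun _ => 0) (fun _ => θ) N Φ) t)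
          (localGibbsLaw σ a₀ (fun _ => 0) (fun _ => θ) N Φ) ≤
        ENNReal.ofReal (((N : ℝ) + 1) * L * Real.sqrt (3 * θ) * t)

/-! ## Card C -/

/-- FIRST LEMMA C — the PAIR TRANSPORT IDENTITY (empirical second hierarchy equation, pathwise):
for one hard-sphere trajectory on `𝕋³`, a smooth one-body weight `b` and a `C¹` pair mark
`P(ξ, v, w)` supported in the microscale shell `1 < |ξ| < R` (`ξ = ε⁻¹(x_i − x_j)`), the change of
the pair observable `N⁻¹ Σ_{i≠j} b(x_i) P(ξ_{ij}, v_i, v_j)` over `[0, τ]` minus its free-streaming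
integral (which carries the factor `ε⁻¹` in front of the `ξ`-gradient) equals the sum over
collision times of its jumps (post minus pre, pre-collisional velocities read off `reflectVel`).
Multiplying by `ε` exhibits the stationary BBGKY₂ equation at the contact scale with an `O(ε)`
defect — the `n = 2` sibling of `EmpiricalEnskogIdentity` (stmt-13086). -/
def PairTransportIdentity : Prop :=
  ∀ (ε R : ℝ) (N : ℕ), 0 < ε → 1 < R → R * ε < 1 / 2 →
    ∀ Φ : HardSphereFlow (Torus.geometry (Fin 3)) ε N, ∀ z ∈ Φ.good, ∀ τ : ℝ, 0 < τ →
      ∀ b : T3 → ℝ, Literature.Analysis.FunctionSpaces.Torus.IsSmooth b →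
        ∀ P : V3 × V3 × V3 → ℝ, ContDiff ℝ 1 P → (∀ q, P q ≠ 0 → 1 < ‖q.1‖ ∧ ‖q.1‖ < R) →
          let G : Geometry (Fin 3) T3 := Torus.geometry (Fin 3)
          let γ : ℝ → Config N (Fin 3) T3 := fun s => Φ.flow s z
          let ξ : ℝ → Fin N → Fin N → V3 := fun s i j => ε⁻¹ • G.sepVec (γ s i).1 (γ s j).1
          let F : ℝ → ℝ := fun s => (N : ℝ)⁻¹ * ∑ i : Fin N, ∑ j : Fin N,
            (if i ≠ j then b (γ s i).1 * P (ξ s i j, (γ s i).2, (γ s j).2) else 0)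
          let S : ℝ → ℝ := fun s => (N : ℝ)⁻¹ * ∑ i : Fin N, ∑ j : Fin N,
            (if i ≠ j then
              (∑ k : Fin 3, (γ s i).2 k *
                  Literature.Analysis.FunctionSpaces.Torus.partialDeriv k b (γ s i).1) *
                P (ξ s i j, (γ s i).2, (γ s j).2) +
              b (γ s i).1 * (ε⁻¹ *
                (fderiv ℝ (fun x : V3 => P (x, (γ s i).2, (γ s j).2)) (ξ s i j))
                  ((γ s i).2 - (γ s j).2))
             else 0)
          let pre : ℝ → Fin N → V3 := fun s i => (γ s i).2 + ∑ k : Fin N,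
            (if k ≠ i ∧ ‖G.sepVec (γ s i).1 (γ s k).1‖ = ε then
              (reflectVel (G.sepVec (γ s i).1 (γ s k).1) ((γ s i).2, (γ s k).2)).1 - (γ s i).2
             else 0)
          F τ - F 0 - ∫ s in Set.Icc (0 : ℝ) τ, S s =
            (N : ℝ)⁻¹ * ∑ᶠ (s : ℝ) (_ : s ∈ collisionTimes G ε γ ∩ Set.Ioc 0 τ),
              ∑ i : Fin N, ∑ j : Fin N,
                (if i ≠ j then b (γ s i).1 *
                  (P (ξ s i j, (γ s i).2, (γ s j).2) - P (ξ s i j, pre s i, pre s j)) else 0)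

/-! ## Card B′ -/

/-- FIRST LEMMA B′ — RUNG 0 INPUT: the local Gibbs law with CONSTANT profiles (canonical
hard-sphere measure times a global Maxwellian) is invariant under every hard-sphere flow (density
is a function of the conserved kinetic energy and momentum times the indicator of the hard-sphere
domain; Liouville measure is preserved). -/
def ConstantProfileInvariance : Prop :=
  ∀ (σ a θ : ℝ) (u : V3) (N : ℕ), 0 < σ → 0 < a → 0 < θ →
    ∀ Φ : HardSphereFlow (Torus.geometry (Fin 3)) (hsDiameter σ N) (N + 1), ∀ t : ℝ,
      Φ.lawAt (localGibbsLaw σ (fun _ => a) (fun _ => u) (fun _ => θ) N Φ) t =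
        localGibbsLaw σ (fun _ => a) (fun _ => u) (fun _ => θ) N Φ

/-! ## Card A — proof of the first lemma (band agreement ⇒ crux) -/

/-- `FirstLemmaA` HOLDS: if the statistic is universal with some `Ỹ` agreeing with the thermodynamic `Y`
on a band `(0, η₁)`, then `EvenStressEnskog`. Uses the disprover's landed Negative lemma
`pairFunctional_eq_zero_of_mollifiedDensity_eq_zero` (`B_r = 0` where `ρ_r = 0`) and `g = 0` on
`[min η₀ η₁, ∞)`. -/
theorem firstLemmaA_holds : FirstLemmaA := by
  intro Yt hU hband
  obtain ⟨η₁, hη₁, hEq⟩ := hband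
  obtain ⟨η₀, hη₀, H⟩ := hU
  refine (evenStressEnskog_iff).mpr ⟨min η₀ η₁, lt_min hη₀ hη₁, ?_⟩
  intro a₀ θ₀ u₀ ha hθ hu ha0 hθ0
  obtain ⟨σ₀, hσ₀, H1⟩ := H a₀ θ₀ u₀ ha hθ hu ha0 hθ0
  refine ⟨σ₀, hσ₀, ?_⟩
  intro σ hσ hσlt Φ τ hτ χ hχ g hg hg0 η δ hη hδ
  have hg0' : ∀ a, η₀ ≤ a → g a = 0 := fun a h => hg0 a ((min_le_left η₀ η₁).trans h)
  obtain ⟨r₀, hr₀, H2⟩ := H1 σ hσ hσlt Φ τ hτ χ hχ g hg hg0' η δ hη hδ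
  refine ⟨r₀, hr₀, ?_⟩
  intro r hr hrlt
  obtain ⟨N₀, H3⟩ := H2 r hr hrlt
  refine ⟨N₀, ?_⟩
  intro N hN ε G γ bx ρm Θ B pv Kc Yv Dm ΞP k l
  have key : Literature.MathematicalPhysics.KineticTheory.localGibbsLaw σ a₀ u₀ θ₀ N (Φ N)
      {z | η < |(Kc (fun z s i j => χ (s, (γ z s i).1) * g (σ ^ 3 * ρm z s (γ z s i).1) *
        (ΞP k l) (ε⁻¹ • G.sepVec (γ z s i).1 (γ z s j).1, (pv z s i j).1, (pv z s i j).2)) z -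
        σ ^ 3 * ∫ s in Set.Icc (0 : ℝ) τ, ∫ x : UnitAddTorus (Fin 3),
          χ (s, x) * g (σ ^ 3 * ρm z s x) * Yt (σ ^ 3 * ρm z s x) * B (ΞP k l) z s x)|} ≤
      ENNReal.ofReal δ :=
    H3 N hN k l
  have hint : ∀ z s x,
      χ (s, x) * g (σ ^ 3 * ρm z s x) * Yt (σ ^ 3 * ρm z s x) * B (ΞP k l) z s x =
        χ (s, x) * g (σ ^ 3 * ρm z s x) * Yv (σ ^ 3 * ρm z s x) * B (ΞP k l) z s x := by
    intro z s x
    by_cases hρ : ρm z s x = 0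
    · have hB : B (ΞP k l) z s x = 0 := by
        have hρ' := hρ
        simp only [ρm, bx] at hρ'
        simp only [B, Θ, bx]
        exact Summit.AtomisticToContinuum.HydrodynamicLimit.Theorems.EvenStressEnskog.pairFunctional_eq_zero_of_mollifiedDensity_eq_zero
          hr (ΞP k l) (γ z s) x hρ'
      rw [hB, mul_zero, mul_zero]
    · have h0 : 0 ≤ ρm z s x := by
        simp only [ρm, bx]
        exact MeasureTheory.integral_nonneg fun q =>
          Summit.AtomisticToContinuum.HydrodynamicLimit.Theorems.EvenStressEnskog.coneMollifier_nonneg hr _ _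
      have hρpos : 0 < ρm z s x := lt_of_le_of_ne h0 (Ne.symm hρ)
      have ha : 0 < σ ^ 3 * ρm z s x := mul_pos (pow_pos hσ 3) hρpos
      by_cases hlt : σ ^ 3 * ρm z s x < min η₀ η₁
      · have hmem : σ ^ 3 * ρm z s x ∈ Set.Ioo 0 η₁ := ⟨ha, hlt.trans_le (min_le_right _ _)⟩
        have e1 : Yt (σ ^ 3 * ρm z s x) = Yv (σ ^ 3 * ρm z s x) := hEq hmem
        rw [e1]
      · have hge : min η₀ η₁ ≤ σ ^ 3 * ρm z s x := not_lt.mp hlt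
        rw [hg0 _ hge]
        ring
  simp_rw [hint] at key
  exact key

end Summit.AtomisticToContinuum.HydrodynamicLimit.Cruxes.EvenStressEnskog.IdeatorOne
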